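import Mathlib.NumberTheory.Cyclotomic.Basic
import Literature.NumberTheory.EllipticCurves.Wuthrich2014.ReducibleDivisibility
import Literature.NumberTheory.EllipticCurves.PAdicLFunctionMinus
import Literature.NumberTheory.EllipticCurves.ImaginaryPeriod
import HarnessLib

/-!
# Wuthrich 2014, Thm. 16 at `p = 3`, read over `K = ℚ(ζ₃)`: `char_Λ X(E/ℚ(ζ_{3^∞})) ∣ L₃(E, ω⁰, T) · L₃(E, ω¹, T)`

Source: C. Wuthrich, *On the integrality of modular symbols and Kato's Euler system for elliptic
curves*, Doc. Math. 19 (2014) 381–402 [Wuthrich2014], **Theorem 16** (p. 397), with §5 (p. 397: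
the Selmer group over `ℚ(ζ_{p^n})`, `X(E)` = the dual of the limit), §1 Thm. 3 ("We formulate it
here for the full cyclotomic `ℤ_p^×`-extension") and §3 (p. 390: for a `ℤ_p[Δ]`-module `M`,
`p ∤ #Δ`, "`M = ⊕ M_i`" over the characters `ω^i` of `Δ`), Lemma 17 and Cor. 18 (p. 398:
`L_p(E) ∈ Λ`). ONE NAMED FACT (`def … : Prop`, nothing asserted, D-0014): the case `p = 3` of
Theorem 16, good ordinary reduction, transcribed WITHOUT any descent to the `ℤ_p`-extension of `ℚ`.

## The reading (why this transcription is verbatim up to semisimple bookkeeping)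

Theorem 16 (p. 397): "Let `E/ℚ` be an elliptic curve and let `p > 2` be a prime. Suppose that `E`
has semi-stable reduction at `p` and that `E[p]` is reducible as a `G_ℚ`-module. Then
`char_Λ X(E)` divides the ideal generated by `L_p(E)`." Here (§3, p. 390; §5, p. 397)
`Λ = ℤ_p⟦G⟧` is "the Iwasawa algebra of the cyclotomic `ℤ_p^×`-extension of `ℚ`",
`G = Gal(ℚ(ζ_{p^∞})/ℚ) ≅ ℤ_p^× = Δ × Γ` (`Δ ≅ (ℤ/p)^×`, `Γ = 1 + pℤ_p`), `X(E)` is the Pontryagin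
dual of `lim_n Sel(E/ℚ(ζ_{p^n}))` (the classical Selmer groups, "defined as usual as the elements
… that are locally in the image of the points", p. 397), and `L_p(E) ∈ Λ` (Cor. 18) is the
analytic `p`-adic `L`-function of `E`, i.e. the Mazur–Swinnerton-Dyer measure `μ_E` on `ℤ_p^×`
built from the modular symbols `[r]^±_E` normalised by the Néron periods `Ω^±_E` (p. 381).

**Take `p = 3` and `K := ℚ(ζ₃) = ℚ(√−3)`.** The fields `ℚ(ζ_{3^{n+1}})`, `n ≥ 0`, are exactly the
layers of the cyclotomic `ℤ₃`-extension `K_∞ = ℚ(ζ_{3^∞})` of the NUMBER FIELD `K`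
(`[ℚ(ζ_{3^{n+1}}) : K] = 3^n`), so `lim_n Sel(E/ℚ(ζ_{3^n})) = Sel_{3^∞}(E/K_∞)` and `X(E)` IS the
Iwasawa module `X(E/K_∞)` of `E_K` over the cyclotomic `ℤ₃`-extension of `K` — the tree's
`WeierstrassCurve.SelmerDualData` for a `K`-model of `E_K`, `κ : ZpExtension K 3` cyclotomic, with
`T = γ − 1` for `γ ∈ Γ_K` mapping to the topological generator `χ₃(γ) = 4 = 1 + 3` of
`Γ = Gal(K_∞/K) ≅ 1 + 3ℤ₃` (`cyclotomicGenerator 3`; the image of `Γ_K` under the cyclotomic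
character is `1 + 3ℤ₃` since `K ∋ ζ₃`). NO descent along `ℚ(ζ_{3^∞}) ⊋ ℚ_∞` is involved (contrast
the trivial-branch transcription `charIdeal_dvd_padicLFunction`, which reads `X(E)` over `ℚ_∞`).

`Λ(G) = ℤ₃[Δ]⟦Γ⟧` with `Δ = {±1}`, `3 ∤ #Δ`: `Λ(G) = Λ(Γ)e₊ ⊕ Λ(Γ)e₋` (`e_± = (1 ± [−1])/2`) and
every `Λ(G)`-module is `M = e₊M ⊕ e₋M` (p. 390, "`M = ⊕ M_i`"); the characteristic ideal of a
finitely generated torsion `Λ(G)`-module is `char(e₊M)e₊ + char(e₋M)e₋`, and "`char_Λ X(E)`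
divides `(L_p(E))`" says `e_± L_p(E) ∈ char_{Λ(Γ)}(e_± X)`. The components of the measure
`L_p(E) = μ_E` are its two tame branches `e₊ L_p ↔ L₃(E, ω⁰, T) = ∫_{ℤ₃^×} (1+T)^{ℓ(x)} dμ_E^+`
(the `3`-adic `L`-function of `E`, tree `padicLFunction`) and
`e₋ L_p ↔ L₃(E, ω¹, T) = ∫_{ℤ₃^×} ω(x)(1+T)^{ℓ(x)} dμ_E^−` (the odd branch, built on the MINUS
modular symbols since `ω` is odd; Mazur–Tate–Teitelbaum 1986 §I.13; tree
`padicLFunctionMinusBranch … 1`). REGARDING `X(E)` AS A `Λ(Γ)`-MODULE (via `Λ(Γ) ⊂ Λ(G)`; this is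
the structure `T = γ − 1` above), `char_{Λ(Γ)} X(E) = char(e₊X) · char(e₋X)` (multiplicativity of
characteristic ideals over `⊕`), hence

  `char_{Λ(Γ)} X(E/K_∞) ∋ (unit) · L₃(E, ω⁰, T) · L₃(E, ω¹, T)`.

Period normalisations (the only translation made, as in `ReducibleDivisibility`): Wuthrich's
`[r]^±_E` are normalised by the Néron periods of `E` (p. 381: `λ(r) = [r]⁺_E Ω⁺_E + [r]⁻_E Ω⁻_E i`),
the tree's `ratPlusSymbol f`/`ratMinusSymbol f` by the newform periods `Ω^±_f`
(`plusPeriod f`, `minusPeriod f`). With `ϖ⁺ · Ω_E = Ω⁺_f` (`Ω_E = realPeriodRat = c_∞ Ω⁺_E`) and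
`ϖ⁻ · |Ω⁻(E)| = Ω⁻_f` (`|Ω⁻(E)| = imaginaryPeriodRat`, Pal's imaginary Néron period; Wuthrich's
`Ω⁻_E` differs from it by a power of `2`), `L₃(E, ω⁰, T) · L₃(E, ω¹, T)` (Néron-normalised) is
`u · ϖ⁺ϖ⁻ · padicLFunction f α · padicLFunctionMinusBranch f α 1` for a `3`-adic unit `u` (signs,
`c_∞ ∈ {1,2}`, powers of `2`), invisible in the ideal statement and kept as an explicit unit.

Hypotheses transcribed: `E = V` globally minimal over `ℚ`, good ordinary at `3` (`IsOrdinaryAt V 3`;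
Thm. 16 is printed for semi-stable reduction — only the good case is transcribed here, as in
`charIdeal_dvd_padicLFunction`; for `3` good with `E[3]` reducible the reduction is ordinary,
§5 p. 397), `E[3]` reducible (`¬ V.HasIrreducibleModPGaloisRep 3`), `K` a cyclotomic extension
`{3}` of `ℚ` (Mathlib `IsCyclotomicExtension {3} ℚ K`, i.e. `K = ℚ(ζ₃)`), `V'` any `K`-model of
`E_K` (`C • V.baseChange K = V'`), `κ` the cyclotomic `ℤ₃`-extension of `K` with topological
generator `γ` matching the cyclotomic variable (`χ₃(γ) · ζ = 4`, `ζ` torsion — the `K`-analogue of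
`IsCyclotomicVariable`), `f` the newform of `E`, `α = unitRoot V 3`, `D` a Pontryagin-dual datum
of `Sel_{3^∞}(E/K_∞)`. Conclusion: `X(E/K_∞)` is `Λ`-torsion (Thm. 16's standing fact, §5 p. 397:
"If the reduction is good ordinary, theorem 17.4 in [Kato] shows that `X(E)` is `Λ`-torsion") and
`u ϖ⁺ϖ⁻ · L₃(E,ω⁰,T) L₃(E,ω¹,T) = ι g` for some `g ∈ char_{Λ(Γ)} X(E/K_∞)`.

What is NOT here: `p ≠ 3` (for `p ≥ 5` the same reading gives `char_{Λ(Γ)} X(E/ℚ(μ_{p^∞})) ∋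
∏_{i mod p−1} L_p(E, ω^i, T)` over `K = ℚ(μ_p)`; not needed by the cell), the multiplicative case
and its `I`-factor, and any proof (Kato's Euler system is not in Mathlib).
-- TODO(general form): Thm. 16 for every odd `p` over `K = ℚ(μ_p)` (product over all `p − 1`
-- branches) and for multiplicative reduction at `p` (with the factor `I` in the split case).

Consumer: the BSD rank-≤1 residual cell (`b2b-bsdres`, sub-cell additive-p4, line V14): with
Greenberg's Euler-characteristic formula over `K` and Milne's Weil-restriction identity this fact
bounds `#Ш(E/ℚ)[3^∞] · #Ш(E^{(−3)}/ℚ)[3^∞]` for the ADDITIVE twist `E^{(−3)}` (class X3 at `p = 3`)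
without any descent `X(E^{(−3)}/ℚ_∞) ≅ X(E/ℚ(μ_{3^∞}))^{(ω)}`.
-/

set_option autoImplicit false

noncomputable section

open scoped Classical MatrixGroups ModularForm

open CongruenceSubgroup WeierstrassCurve Literature.NumberTheory.EllipticCurves
  Literature.NumberTheory.EllipticCurves.ModularForms
  Literature.NumberTheory.GaloisRepresentations

namespace Literature.NumberTheory.EllipticCurves.Wuthrich2014

/-- **Wuthrich 2014, Theorem 16 at `p = 3`, good ordinary case, read over `K = ℚ(ζ₃)`:
`char_{Λ(Γ)} X(E/ℚ(ζ_{3^∞})) ∋ u · L₃(E, ω⁰, T) · L₃(E, ω¹, T)`.** As printed (Doc. Math. 19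
(2014), Thm. 16, p. 397): "Let `E/ℚ` be an elliptic curve and let `p > 2` be a prime. Suppose that
`E` has semi-stable reduction at `p` and that `E[p]` is reducible as a `G_ℚ`-module. Then
`char_Λ X(E)` divides the ideal generated by `L_p(E)`." — with `Λ = ℤ_p⟦Gal(ℚ(ζ_{p^∞})/ℚ)⟧`
(§1 Thm. 3: "for the full cyclotomic `ℤ_p^×`-extension"; §3 p. 390), `X(E)` the dual of
`lim_n Sel(E/ℚ(ζ_{p^n}))` (§5 p. 397) and `L_p(E) ∈ Λ` (Cor. 18, p. 398) the Néron-normalised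
Mazur–Swinnerton-Dyer measure on `ℤ_p^×` (p. 381). For `p = 3` the tower `ℚ(ζ_{3^{n+1}})` is the
cyclotomic `ℤ₃`-extension `K_∞` of the number field `K = ℚ(ζ₃)`, so `X(E) = X(E/K_∞)` is the tree's
Iwasawa module of (any `K`-model `V'` of) `E_K` for `κ : ZpExtension K 3` cyclotomic, `T = γ − 1`,
`χ₃(γ) = 4`; and since `Λ = Λ(Γ)e₊ ⊕ Λ(Γ)e₋` (`Δ = {±1}`, `3 ∤ #Δ`; p. 390 "`M = ⊕ M_i`") the
printed divisibility says `e_±L_p(E) ∈ char(e_±X)`, whence — characteristic ideals being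
multiplicative over `X = e₊X ⊕ e₋X` — `char_{Λ(Γ)} X(E/K_∞) ∋ L₃(E,ω⁰,T) · L₃(E,ω¹,T)`, the two
tame branches of `μ_E` (Mazur–Tate–Teitelbaum 1986 §I.13: the even branch on `[·]⁺`, the odd
branch on `[·]⁻`). In the tree's normalisation by the newform periods
(`ϖ · Ω_E = Ω⁺_f`, `ϖ' · |Ω⁻(E)| = Ω⁻_f`): `X(E/K_∞)` is `Λ`-torsion (§5 p. 397, via Kato Thm. 17.4)
and `u · ϖϖ' · padicLFunction f α · padicLFunctionMinusBranch f α 1 = ι g` for some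
`g ∈ char_Λ X(E/K_∞)` and a unit `u ∈ ℤ₃^×` (signs, `c_∞`, powers of `2` between Wuthrich's `Ω⁻_E`
and Pal's `|Ω⁻(E)|`), `α = unitRoot V 3`, `ι = iwasawaToPowerSeries 3 : Λ ↪ ℚ₃⟦T⟧`.
Transcribed for good ordinary `3` only (`IsOrdinaryAt V 3`; printed for semi-stable `p`).
**RETIRED as a separate named fact (cell `b2b-bsdres`, referee ruling R120.2, 2026-08-20, endorsing
lit C175 (ii); deprecate-and-add):** this `p = 3`, `F = K` special case is a KERNEL CONSEQUENCE of the
odd-`p` reading `Wuthrich2014.charIdeal_dvd_padicLFunction_cyclotomicPrime`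
(`ReducibleDivisibilityCyclotomicPrime.lean`, p228361) — derivation
`Wuthrich2014.charIdeal_dvd_padicLFunction_cyclotomicThree_of_cyclotomicPrime`
(`ReducibleDivisibilityCyclotomicThreeOfPrime.lean`, p238147); the cell's class-level consumers were
re-based on the odd-`p` readings in
`Summits/BirchSwinnertonDyer/Rank1Residual/Additive/SemistableTwistRankZeroThreeClassOfPrime.lean`
(p238590). New consumers take the general fact; existing consumers migrate to the `…OfPrime` form
when next touched; this `def` is kept verbatim only until no module references it, then removed.
[cite: Wuthrich2014, Thm. 16 (p. 397), §5 (p. 397), §3 (p. 390), Cor. 18 (p. 398)]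
[cite: MazurTateTeitelbaum1986Invent, §I.13] -/
def charIdeal_dvd_padicLFunction_cyclotomicThree : Prop :=
  ∀ (V : WeierstrassCurve ℚ) [V.IsElliptic] [V.IsGloballyMinimal]
    (K : Type) [Field K] [NumberField K] [IsCyclotomicExtension {3} ℚ K]
    (V' : WeierstrassCurve K) [V'.IsElliptic]
    {κ : ZpExtension K 3} {γ : Field.absoluteGaloisGroup K} {N : ℕ} [NeZero N]
    {f : CuspForm (Gamma0 N) 2},
    IsOrdinaryAt V 3 → ¬ V.HasIrreducibleModPGaloisRep 3 →
    (∃ C : VariableChange K, C • V.baseChange K = V') →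
    κ.IsCyclotomic → κ.IsTopGenerator γ →
    (∃ ζ : ℤ_[3]ˣ, IsOfFinOrder ζ ∧
      ((GaloisRep.cyclotomicCharacter K 3 γ * ζ : ℤ_[3]ˣ) : ℤ_[3]) =
        (cyclotomicGenerator 3 : ℤ_[3])) →
    IsNewformOf V f →
    ∀ (D : V'.SelmerDualData κ γ) (ϖ ϖ' : ℚ),
      (ϖ : ℝ) * V.realPeriodRat = plusPeriod f →
      (ϖ' : ℝ) * V.imaginaryPeriodRat = minusPeriod f →
      D.IsTorsion ∧
      ∃ g ∈ D.charIdeal, ∃ u : ℤ_[3]ˣ,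
        iwasawaToPowerSeries 3 g =
          PowerSeries.C (((u : ℤ_[3]) : ℚ_[3]) * (ϖ : ℚ_[3]) * (ϖ' : ℚ_[3])) *
            (padicLFunction f ((unitRoot V 3 : ℤ_[3]) : ℚ_[3]) *
              padicLFunctionMinusBranch f ((unitRoot V 3 : ℤ_[3]) : ℚ_[3]) 1)

end Literature.NumberTheory.EllipticCurves.Wuthrich2014

end
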